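import Literature.NumberTheory.Sieve.Polymath8aSmoothSiegelWalfisz
import Literature.NumberTheory.Sieve.DivisorPowerSums
import HarnessLib

/-!
# Polymath 8a, Definition 2.5 (coefficient sequences) and Lemma 3.4 (i), (iii) in that vocabulary

Support file for the named fact `Literature.NumberTheory.Sieve.mpz_of_lt` (**parity.S29**,
`ParityWave0.lean`): D. H. J. Polymath, *New equidistribution estimates of Zhang type*, Algebra &
Number Theory 8:9 (2014) 2067–2199 = arXiv:1402.0811.  The Type I/II/III estimates (Definition 2.6)
through which Lemma 2.7 proves `MPZ^{(i)}[ϖ, δ]` (the tree's `MPZi`) are statements about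
*coefficient sequences* (Definition 2.5): sequences with divisor-type bounds (2.2), *located at a
scale*, possibly with the *Siegel–Walfisz property* or *smooth at a scale*.  The paper's asymptotic
conventions ("fixed", `≪`, `O(1)` exponents) hide a finite list of constants; this file vendors
Definition 2.5 with those constants explicit, in the uniform style of the tree's `MPZ`/`MPZi`
(every implicit fixed quantity becomes a parameter; `Δ` is the tree's `apDiscrepancy`), and PROVES
Lemma 3.4 (i) and the general case of Lemma 3.4 (iii) in this vocabulary:

* `IsCoeffBound K B x α` — (2.2): `|α(n)| ≤ K τ(n)^B (log x)^B` (`n ≥ 1`);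
* `IsLocatedAtScale c C N α` — Definition 2.5 (i): `α(n) ≠ 0 ⟹ cN ≤ n ≤ CN`;
* `HasSiegelWalfisz Csw Bsw x N X α` — Definition 2.5 (ii):
  `|Δ(α 1_{(·,r)=1}; a (q))| ≤ Csw(A) τ(qr)^{Bsw} N (log x)^{-A}` for all `A`, `q, r ≥ 1`,
  `a (q)` primitive (window `[1, X]`);
* `IsSmoothAtScale c C Kd Bd x N α` — Definition 2.5 (iii) (`x₀ = 0`): `α(n) = ψ(n/N)`, `ψ` smooth,
  `supp ψ ⊆ [c, C]`, `|ψ^{(j)}| ≤ Kd(j) (log x)^{Bd(j)}`;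
* Lemma 3.4 (i): `IsLocatedAtScale.mul` (supports multiply), `IsCoeffBound.mul` (the divisor bound
  passes to `α ⋆ β` with exponent `B + B' + 1`, tree `abs_mul_apply_le_sigma_zero_pow`);
  `IsSmoothAtScale.isLocatedAtScale`, `IsSmoothAtScale.isCoeffBound`;
* Lemma 3.4 (iii), general case: `HasSiegelWalfisz.mul` — the Siegel–Walfisz property passes from
  `β` to `α ⋆ β` with explicit constants (from `Polymath8a.abs_apDiscrepancy_coprime_mul_le` and the
  `L¹` bound `∑|α| ≪ M (log x)^{O(1)}` by `exists_sum_sigma_zero_pow_le_real`; the printed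
  Brun–Titchmarsh refinement is not needed).

The smooth case of Lemma 3.4 (iii) and the Möbius pieces are `Polymath8aSmoothSiegelWalfisz.lean`
and `Polymath8aMoebiusSiegelWalfisz.lean`; Definition 2.6 and Lemma 2.7 are not stated here.
Nothing in this file discharges `mpz_of_lt`.

## References

* D. H. J. Polymath, *New equidistribution estimates of Zhang type*, Algebra & Number Theory 8:9
  (2014), 2067–2199, arXiv:1402.0811: Definition 2.5, (2.2); Lemma 3.4 (i), (iii) and their proofs
  (§3). [cite: Polymath8a2014]
-/

open Finset MeasureTheory
open scoped ArithmeticFunction.sigma ContDiff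

namespace Literature.NumberTheory.Sieve

namespace Polymath8a

/-! ### Definition 2.5: coefficient sequences -/

/-- **Coefficient bound (2.2)** of Polymath 8a, Definition 2.5 ("a coefficient sequence is a finitely
supported sequence `α : ℕ → ℝ` (which may depend on `x`) that obeys the bounds
`|α(n)| ≪ τ^{O(1)}(n) log^{O(1)}(x)` for all `n`"), with the two implicit fixed quantities made
explicit: an exponent `B` and a constant `K`, `|α(n)| ≤ K τ(n)^B (log x)^B` for all `n ≥ 1`
(one exponent serves for `τ` and `log`, which loses nothing; `n = 0` does not occur in the paper's
`ℕ = {1, 2, …}`). [cite: Polymath8a2014, Definition 2.5, (2.2)] -/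
def IsCoeffBound (K : ℝ) (B : ℕ) (x : ℝ) (α : ℕ → ℝ) : Prop :=
  ∀ n : ℕ, n ≠ 0 → |α n| ≤ K * (σ 0 n : ℝ) ^ B * Real.log x ^ B

/-- **Located at scale `N`** (Polymath 8a, Definition 2.5 (i): "`α` is said to be located at scale
`N` for some `N ≥ 1` if it is supported on an interval of the form `[cN, CN]` for some
`1 ≪ c < C ≪ 1`"), with the fixed support constants `c, C` explicit: for `n ≥ 1`,
`α(n) ≠ 0 ⟹ cN ≤ n ≤ CN`. [cite: Polymath8a2014, Definition 2.5 (i)] -/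
def IsLocatedAtScale (c C : ℝ) (N : ℝ) (α : ℕ → ℝ) : Prop :=
  ∀ n : ℕ, n ≠ 0 → α n ≠ 0 → c * N ≤ n ∧ (n : ℝ) ≤ C * N

/-- **The Siegel–Walfisz property at scale `N`** (Polymath 8a, Definition 2.5 (ii): "`α` located at
scale `N` is said to obey the Siegel–Walfisz theorem if one has
`|Δ(α 1_{(·,r)=1}; a (q))| ≪ τ(qr)^{O(1)} N log^{-A} x` for any `q, r ≥ 1`, any fixed `A`, and any
primitive residue class `a (q)`"), with the implicit fixed data explicit: a divisor exponent `Bsw`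
and, for each `A`, a constant `Csw A`; `Δ` is the tree's `apDiscrepancy` on a window `[1, X]`
containing the support (its value does not depend on such `X`, `apDiscrepancy_eq_of_support`).
[cite: Polymath8a2014, Definition 2.5 (ii)] -/
def HasSiegelWalfisz (Csw : ℝ → ℝ) (Bsw : ℕ) (x N : ℝ) (X : ℕ) (α : ℕ → ℝ) : Prop :=
  ∀ A : ℝ, ∀ q : ℕ, 0 < q → ∀ r : ℕ, 0 < r → ∀ a : (ZMod q)ˣ,
    |apDiscrepancy (fun n => if Nat.Coprime n r then α n else 0) X q a| ≤
      Csw A * (σ 0 (q * r) : ℝ) ^ Bsw * N / Real.log x ^ A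

/-- **Smooth at scale `N`** (Polymath 8a, Definition 2.5 (iii) with `x₀ = 0`: "`α(n) = ψ(n/N)` for
some smooth function `ψ` supported on an interval `[c, C]` for some fixed `0 < c < C` … obeying
`|ψ^{(j)}(x)| ≪ log^{O(1)} x` for all fixed `j ≥ 0`, where the implied constant may depend on `j`"),
with the fixed data explicit: the support constants `c, C` and, for each `j`, a constant `Kd j` and
an exponent `Bd j`; `ψ` is real-valued (coefficient sequences are real) and the identity
`α(n) = ψ(n/N)` is asked for `n ≥ 1`. [cite: Polymath8a2014, Definition 2.5 (iii)] -/
def IsSmoothAtScale (c C : ℝ) (Kd : ℕ → ℝ) (Bd : ℕ → ℕ) (x N : ℝ) (α : ℕ → ℝ) : Prop :=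
  ∃ ψ : ℝ → ℝ, ContDiff ℝ ∞ ψ ∧ (∀ t, ψ t ≠ 0 → c ≤ t ∧ t ≤ C) ∧
    (∀ (j : ℕ) (t : ℝ), |iteratedDeriv j ψ t| ≤ Kd j * Real.log x ^ Bd j) ∧
    ∀ n : ℕ, 1 ≤ n → α n = ψ (n / N)

/-! ### Elementary API -/

/-- Powers of `log x` compare up to constants for `x ≥ 2` (`log 2 ≥ 1/2`): for `B ≤ B'`,
`(log x)^B ≤ 2^{B'−B} (log x)^{B'}`. [folklore] -/
theorem log_pow_le_two_pow_mul_log_pow {x : ℝ} (hx : 2 ≤ x) {B B' : ℕ} (h : B ≤ B') :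
    Real.log x ^ B ≤ (2 : ℝ) ^ (B' - B) * Real.log x ^ B' := by
  have hlog : 1 / 2 ≤ Real.log x := by
    have h2 : (1 / 2 : ℝ) ≤ Real.log 2 := by
      have := Real.log_two_gt_d9; norm_num at this ⊢; linarith
    exact h2.trans (Real.log_le_log (by norm_num) hx)
  have hL0 : 0 ≤ Real.log x := by linarith
  obtain ⟨d, rfl⟩ := Nat.exists_eq_add_of_le h
  rw [Nat.add_sub_cancel_left, pow_add]
  have h1 : (1 : ℝ) ≤ 2 ^ d * Real.log x ^ d := by
    rw [← mul_pow]; exact one_le_pow₀ (by linarith)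
  calc Real.log x ^ B = Real.log x ^ B * 1 := (mul_one _).symm
    _ ≤ Real.log x ^ B * (2 ^ d * Real.log x ^ d) :=
        mul_le_mul_of_nonneg_left h1 (pow_nonneg hL0 B)
    _ = 2 ^ d * (Real.log x ^ B * Real.log x ^ d) := by ring

/-- A located sequence vanishes beyond `⌊CN⌋` (the window in which its discrepancies are taken).
[cite: Polymath8a2014, Definition 2.5 (i)] -/
theorem IsLocatedAtScale.eq_zero_of_lt {c C N : ℝ} {α : ℕ → ℝ} (h : IsLocatedAtScale c C N α) {n : ℕ}
    (hn : ⌊C * N⌋₊ < n) : α n = 0 := by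
  by_contra hne
  have hn0 : n ≠ 0 := by omega
  have h2 := (h n hn0 hne).2
  exact absurd (Nat.le_floor h2) (not_le.mpr hn)

/-- **Lemma 3.4 (i), support**: "if `α, β` are coefficient sequences located at scales `N, M`
respectively, then `α ⋆ β` is a coefficient sequence located at scale `NM`" — the support part:
supports multiply under Dirichlet convolution. [cite: Polymath8a2014, Lemma 3.4 (i) (proof)] -/
theorem IsLocatedAtScale.mul {c C M c' C' N : ℝ} (hc' : 0 ≤ c') (hN : 0 ≤ N)
    {F G : ArithmeticFunction ℝ} (hF : IsLocatedAtScale c C M F) (hG : IsLocatedAtScale c' C' N G) :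
    IsLocatedAtScale (c * c') (C * C') (M * N) ⇑(F * G) := by
  intro n hn0 hn
  rw [ArithmeticFunction.mul_apply] at hn
  obtain ⟨p, hp, hpne⟩ := Finset.exists_ne_zero_of_sum_ne_zero hn
  have hpn := Nat.mem_divisorsAntidiagonal.mp hp
  have hF0 : F p.1 ≠ 0 := fun h => hpne (by rw [h, zero_mul])
  have hG0 : G p.2 ≠ 0 := fun h => hpne (by rw [h, mul_zero])
  have hp1 : p.1 ≠ 0 := fun h => hpn.2 (by rw [← hpn.1, h, zero_mul])
  have hp2 : p.2 ≠ 0 := fun h => hpn.2 (by rw [← hpn.1, h, mul_zero])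
  obtain ⟨h1, h2⟩ := hF p.1 hp1 hF0
  obtain ⟨h3, h4⟩ := hG p.2 hp2 hG0
  have hn' : (n : ℝ) = p.1 * p.2 := by rw [← hpn.1]; push_cast; ring
  rw [hn']
  refine ⟨?_, ?_⟩
  · calc c * c' * (M * N) = (c * M) * (c' * N) := by ring
      _ ≤ p.1 * p.2 := mul_le_mul h1 h3 (by positivity) (Nat.cast_nonneg _)
  · calc (p.1 : ℝ) * p.2 ≤ (C * M) * (C' * N) :=
          mul_le_mul h2 h4 (Nat.cast_nonneg _) ((Nat.cast_nonneg _).trans h2)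
      _ = C * C' * (M * N) := by ring

/-- **Lemma 3.4 (i), size**: the Dirichlet convolution of sequences obeying (2.2) with data
`(K, B)`, `(K', B')` obeys (2.2) with data `(2KK', B + B' + 1)` (for `x ≥ 2`), by the tree's
`abs_mul_apply_le_sigma_zero_pow` (`|F ⋆ G| ≤ A B' τ^{a+b+1}` from `|F| ≤ A τ^a`, `|G| ≤ B' τ^b`) and
`(log x)^{B+B'} ≤ 2 (log x)^{B+B'+1}`. [cite: Polymath8a2014, Lemma 3.4 (i) (proof)] -/
theorem IsCoeffBound.mul {K K' x : ℝ} {B B' : ℕ} (hK : 0 ≤ K) (hK' : 0 ≤ K') (hx : 2 ≤ x)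
    {F G : ArithmeticFunction ℝ} (hF : IsCoeffBound K B x F) (hG : IsCoeffBound K' B' x G) :
    IsCoeffBound (2 * K * K') (B + B' + 1) x ⇑(F * G) := by
  have hL : 0 ≤ Real.log x := Real.log_nonneg (by linarith)
  have hF' : ∀ d, |F d| ≤ K * Real.log x ^ B * (σ 0 d : ℝ) ^ B := by
    intro d
    rcases Nat.eq_zero_or_pos d with rfl | hd
    · simp only [ArithmeticFunction.map_zero, abs_zero]; positivity
    · calc |F d| ≤ K * (σ 0 d : ℝ) ^ B * Real.log x ^ B := hF d hd.ne'
        _ = K * Real.log x ^ B * (σ 0 d : ℝ) ^ B := by ring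
  have hG' : ∀ e, |G e| ≤ K' * Real.log x ^ B' * (σ 0 e : ℝ) ^ B' := by
    intro e
    rcases Nat.eq_zero_or_pos e with rfl | he
    · simp only [ArithmeticFunction.map_zero, abs_zero]; positivity
    · calc |G e| ≤ K' * (σ 0 e : ℝ) ^ B' * Real.log x ^ B' := hG e he.ne'
        _ = K' * Real.log x ^ B' * (σ 0 e : ℝ) ^ B' := by ring
  intro n hn
  have h := abs_mul_apply_le_sigma_zero_pow (by positivity) (by positivity) hF' hG' n
  refine h.trans ?_
  have hlog : Real.log x ^ (B + B') ≤ 2 * Real.log x ^ (B + B' + 1) := by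
    have := log_pow_le_two_pow_mul_log_pow hx (Nat.le_succ (B + B'))
    rwa [Nat.succ_sub (le_refl _), Nat.sub_self, pow_one] at this
  have hτ : (0 : ℝ) ≤ (σ 0 n : ℝ) ^ (B + B' + 1) := by positivity
  calc K * Real.log x ^ B * (K' * Real.log x ^ B') * (σ 0 n : ℝ) ^ (B + B' + 1)
      = K * K' * Real.log x ^ (B + B') * (σ 0 n : ℝ) ^ (B + B' + 1) := by ring
    _ ≤ K * K' * (2 * Real.log x ^ (B + B' + 1)) * (σ 0 n : ℝ) ^ (B + B' + 1) := by
        gcongr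
    _ = 2 * K * K' * (σ 0 n : ℝ) ^ (B + B' + 1) * Real.log x ^ (B + B' + 1) := by ring

/-- A sequence smooth at scale `N > 0` with support constants `c, C` is located at scale `N` with the
same constants ("note that such sequences are also located at scale `N`", Definition 2.5 (iii)).
[cite: Polymath8a2014, Definition 2.5 (iii)] -/
theorem IsSmoothAtScale.isLocatedAt {c C : ℝ} {Kd : ℕ → ℝ} {Bd : ℕ → ℕ} {x N : ℝ} (hN : 0 < N)
    {α : ℕ → ℝ} (h : IsSmoothAtScale c C Kd Bd x N α) : IsLocatedAtScale c C N α := by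
  obtain ⟨ψ, -, hsupp, -, hα⟩ := h
  intro n hn0 hn
  rw [hα n (Nat.pos_of_ne_zero hn0)] at hn
  obtain ⟨h1, h2⟩ := hsupp _ hn
  exact ⟨by rwa [le_div_iff₀ hN] at h1, by rwa [div_le_iff₀ hN] at h2⟩

/-- A sequence smooth at scale `N` obeys (2.2) with data `(Kd 0, Bd 0)`: `|α(n)| = |ψ(n/N)| ≤
Kd 0 (log x)^{Bd 0} ≤ Kd 0 τ(n)^{Bd 0} (log x)^{Bd 0}`. [cite: Polymath8a2014, Definition 2.5 (iii)] -/
theorem IsSmoothAtScale.isCoeffBound {c C : ℝ} {Kd : ℕ → ℝ} {Bd : ℕ → ℕ} {x N : ℝ}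
    {α : ℕ → ℝ} (h : IsSmoothAtScale c C Kd Bd x N α) : IsCoeffBound (Kd 0) (Bd 0) x α := by
  obtain ⟨ψ, -, -, hder, hα⟩ := h
  intro n hn0
  rw [hα n (Nat.pos_of_ne_zero hn0)]
  have h0 := hder 0 (n / N)
  rw [iteratedDeriv_zero] at h0
  have hK : 0 ≤ Kd 0 * Real.log x ^ Bd 0 := (abs_nonneg _).trans h0
  have hτ : (1 : ℝ) ≤ (σ 0 n : ℝ) ^ Bd 0 :=
    one_le_pow₀ (by exact_mod_cast one_le_sigma_zero hn0)
  calc |ψ (n / N)| ≤ (Kd 0 * Real.log x ^ Bd 0) * 1 := by rw [mul_one]; exact h0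
    _ ≤ (Kd 0 * Real.log x ^ Bd 0) * (σ 0 n : ℝ) ^ Bd 0 := mul_le_mul_of_nonneg_left hτ hK
    _ = Kd 0 * (σ 0 n : ℝ) ^ Bd 0 * Real.log x ^ Bd 0 := by ring

/-- **Lemma 3.4 (iii), general case, in the vocabulary of Definition 2.5**: "if `α, β` are
coefficient sequences located at scales `N, M` respectively with `x^ε ≪ M ≪ x^C` …, and `β`
satisfies the Siegel–Walfisz property, then so does `α ⋆ β`."  Precisely: if `F` obeys (2.2) with
`(K, B)` and is located at scale `M` with constants `c, C` (`1 ≤ C`, `1 ≤ M`, `CM ≤ x`), and `G`,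
supported on `[1, X₂]`, has the Siegel–Walfisz property at scale `N` with data `(Csw, Bsw)` on the
window `X₂`, then `F ⋆ G` has the Siegel–Walfisz property at scale `MN` on any window
`X ≥ ⌊CM⌋ X₂`, with the same divisor exponent and the constants
`A ↦ 2 C C_τ K · Csw(A + B + 2^{B+1})`, `C_τ` the constant of `∑_{n ≤ y} τ(n)^B ≤ C_τ y (log y)^{2^{B+1}}`
(`exists_sum_sigma_zero_pow_le_real`).  The route is `abs_apDiscrepancy_coprime_mul_le` and the `L¹`
bound `∑ |F| ≤ 2 C C_τ K M (log x)^{B + 2^{B+1}}` (in place of the printed Brun–Titchmarsh step).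
[cite: Polymath8a2014, Lemma 3.4 (iii) and its proof] -/
theorem HasSiegelWalfisz.mul {K x c C M N : ℝ} {B Bsw : ℕ} {Csw : ℝ → ℝ} {X₂ X : ℕ}
    {Cτ : ℝ} (hCτ0 : 0 ≤ Cτ)
    (hCτ : ∀ y : ℝ, 2 ≤ y → ∑ n ∈ Icc 1 ⌊y⌋₊, (σ 0 n : ℝ) ^ B ≤ Cτ * y * Real.log y ^ (2 ^ (B + 1)))
    (hK : 0 ≤ K) (hx : 2 ≤ x) (hC : 1 ≤ C) (hM : 1 ≤ M) (hMx : 2 * C * M ≤ x)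
    {F G : ArithmeticFunction ℝ} (hFb : IsCoeffBound K B x F) (hFl : IsLocatedAtScale c C M F)
    (hG : HasSiegelWalfisz Csw Bsw x N X₂ G) (hGs : ∀ n, X₂ < n → G n = 0)
    (hCsw : ∀ A, 0 ≤ Csw A) (hN : 0 ≤ N) (hX : ⌊C * M⌋₊ * X₂ ≤ X) :
    HasSiegelWalfisz (fun A => 2 * C * Cτ * K * Csw (A + (B + 2 ^ (B + 1) : ℕ))) Bsw x (M * N) X
      ⇑(F * G) := by
  intro A q hq r hr a
  haveI : NeZero q := ⟨hq.ne'⟩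
  have hL : 0 < Real.log x := Real.log_pos (by linarith)
  set B₁ : ℕ := B + 2 ^ (B + 1) with hB₁
  -- the `L¹` bound for `F`
  have hCM2 : 2 ≤ 2 * C * M := by nlinarith
  have hL1 : ∑ d ∈ Icc 1 ⌊C * M⌋₊, |F d| ≤ 2 * C * Cτ * K * M * Real.log x ^ B₁ := by
    have hsub : Icc 1 ⌊C * M⌋₊ ⊆ Icc 1 ⌊2 * C * M⌋₊ :=
      Finset.Icc_subset_Icc_right (Nat.floor_le_floor (by nlinarith))
    have hlog0 : 0 ≤ Real.log (2 * C * M) := Real.log_nonneg (by linarith)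
    have hlog2CM : Real.log (2 * C * M) ≤ Real.log x := Real.log_le_log (by linarith) hMx
    calc ∑ d ∈ Icc 1 ⌊C * M⌋₊, |F d|
        ≤ ∑ d ∈ Icc 1 ⌊C * M⌋₊, K * (σ 0 d : ℝ) ^ B * Real.log x ^ B :=
          Finset.sum_le_sum fun d hd => hFb d (by have := (Finset.mem_Icc.mp hd).1; omega)
      _ = K * Real.log x ^ B * ∑ d ∈ Icc 1 ⌊C * M⌋₊, (σ 0 d : ℝ) ^ B := by
          rw [Finset.mul_sum]; exact Finset.sum_congr rfl fun d _ => by ring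
      _ ≤ K * Real.log x ^ B * ∑ d ∈ Icc 1 ⌊2 * C * M⌋₊, (σ 0 d : ℝ) ^ B := by
          gcongr
      _ ≤ K * Real.log x ^ B * (Cτ * (2 * C * M) * Real.log (2 * C * M) ^ (2 ^ (B + 1))) := by
          gcongr
          exact hCτ _ hCM2
      _ ≤ K * Real.log x ^ B * (Cτ * (2 * C * M) * Real.log x ^ (2 ^ (B + 1))) := by
          gcongr
      _ = 2 * C * Cτ * K * M * Real.log x ^ B₁ := by rw [hB₁, pow_add]; ring
  -- Siegel–Walfisz for `G` with `A + B₁`, and the inheritance inequality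
  have hB : ∀ b : (ZMod q)ˣ, |apDiscrepancy (fun n => if Nat.Coprime n r then G n else 0) X₂ q b| ≤
      Csw (A + (B₁ : ℕ)) * (σ 0 (q * r) : ℝ) ^ Bsw * N / Real.log x ^ (A + (B₁ : ℕ)) :=
    fun b => hG (A + (B₁ : ℕ)) q hq r hr b
  have hFs : ∀ n, ⌊C * M⌋₊ < n → F n = 0 := fun n hn => hFl.eq_zero_of_lt hn
  have h := abs_apDiscrepancy_coprime_mul_le F G hFs hGs hX r a hB
  refine h.trans ?_
  have hlogpow : Real.log x ^ (A + (B₁ : ℕ)) = Real.log x ^ A * Real.log x ^ B₁ := by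
    rw [Real.rpow_add hL, Real.rpow_natCast]
  have hLA : 0 < Real.log x ^ A := Real.rpow_pos_of_pos hL A
  have hLB : 0 < Real.log x ^ B₁ := pow_pos hL B₁
  rw [hlogpow]
  calc (∑ d ∈ Icc 1 ⌊C * M⌋₊, |F d|) *
        (Csw (A + (B₁ : ℕ)) * (σ 0 (q * r) : ℝ) ^ Bsw * N / (Real.log x ^ A * Real.log x ^ B₁))
      ≤ (2 * C * Cτ * K * M * Real.log x ^ B₁) *
        (Csw (A + (B₁ : ℕ)) * (σ 0 (q * r) : ℝ) ^ Bsw * N / (Real.log x ^ A * Real.log x ^ B₁)) :=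
        mul_le_mul_of_nonneg_right hL1
          (div_nonneg (by have := hCsw (A + (B₁ : ℕ)); positivity) (by positivity))
    _ = 2 * C * Cτ * K * Csw (A + (B₁ : ℕ)) * (σ 0 (q * r) : ℝ) ^ Bsw * (M * N) /
        Real.log x ^ A := by
        field_simp

end Polymath8a

end Literature.NumberTheory.Sieve
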